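import Literature.Topology.FourManifolds.SurfaceGroupAutSymplectic
import Literature.Algebra.Lie.SurfaceLieAlgebra
import HarnessLib

/-!
# Stub `stub_autAbelianizeSymplectic` of line `nilpotent-genus-class` for crux
# `CongruenceShadows.ShadowApproximation` (item stmt-SmoothPoincare4-14595) — `Aut S_g` acts `±`-symplectically

Notation: `S_g = SurfaceGroup g = ⟨a₁,b₁,…,a_g,b_g ∣ ∏[aᵢ,bᵢ]⟩`, `H₁ = (surfaceGen g → ℤ) = ℤ^{2g}` with the
Hurewicz map `SurfaceGroup.abelianize g : S_g →* Multiplicative H₁` and the intersection form `symplForm = ν`.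

**`stub_autAbelianizeSymplectic`** (registered, proved verbatim): for every `g` and every automorphism `φ`
of `S_g` there are a `ℤ`-linear automorphism `F` of `H₁` and `ε ∈ {1, -1}` with
`ab ∘ φ = F ∘ ab` and `ν(F u, F v) = ε ν(u, v)` for all `u v`, i.e. `im(Aut S_g → GL_{2g}(ℤ)) ⊆ Sp^{±}(2g, ℤ)`
(Zieschang–Vogt–Coldewey Thm. 3.6.7 (a) for automorphisms induced by homeomorphisms, which all are by
Nielsen 1927 / ZVC 3.3.11).

Proof.  This is the Literature theorem `Literature.Topology.FourManifolds.SurfaceGroup.exists_linearEquiv_symplectic`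
(`Literature/Topology/FourManifolds/SurfaceGroupAutSymplectic.lean`, landed for this stub), whose proof is
purely algebraic: `F = φ_*` exists because `ab` is onto with characteristic kernel; for `u, v ∈ ℤ^{2g}` the
Heisenberg representation `y ↦ (u_y, v_y, 0)` of `S_g` over `ℤ/ν(u,v)` composed with `φ` evaluates the
relator to `(0, 0, ν(Fᵀu, Fᵀv)) = 1`, so `ν(u,v) ∣ ν(Fᵀu, Fᵀv)` (`SurfaceGroupCharacterPullback.lean`); the
same for `φ⁻¹` gives `|ν(Fᵀu, Fᵀv)| = |ν(u, v)|`; the sign is uniform (test `aᵢ + aⱼ` against `bᵢ + bⱼ`);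
and `M J Mᵀ = εJ ⇒ Mᵀ J M = εJ`.  No new definitions, no named facts (unconditional).
-/

-- the prescribed namespace `Summit.<P>.<Sub>.…` duplicates `SmoothPoincare4` (P = Sub)
set_option linter.dupNamespace false
noncomputable section
open Literature.Topology.FourManifolds Literature.Algebra.Lie Multiplicative

namespace Summit.SmoothPoincare4.SmoothPoincare4.Theorems.ShadowApproximation.NilpotentGenusClass

/-! ## The stub -/

/-- **Stub `stub_autAbelianizeSymplectic`** (line `nilpotent-genus-class`): every automorphism `φ` of the
surface group `S_g` acts on `H₁ = ℤ^{2g}` by a `ℤ`-linear automorphism `F` (`ab ∘ φ = F ∘ ab`) which is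
`ε`-symplectic for the intersection form, `ν(F u, F v) = ε ν(u, v)`, for a single sign `ε = ±1`
(`im(Aut S_g → GL_{2g}(ℤ)) ⊆ Sp^{±}`; ZVC 3.6.7 (a) + Nielsen).  The Literature theorem
`SurfaceGroup.exists_linearEquiv_symplectic`. [cite: ZieschangVogtColdewey1980, Thm 3.6.7 (a)] -/
theorem stub_autAbelianizeSymplectic :
    ∀ (g : ℕ) (φ : SurfaceGroup g ≃* SurfaceGroup g),
      ∃ (F : (surfaceGen g → ℤ) ≃ₗ[ℤ] (surfaceGen g → ℤ)) (ε : ℤ), (ε = 1 ∨ ε = -1) ∧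
        (∀ s : SurfaceGroup g,
          toAdd (SurfaceGroup.abelianize g (φ s)) = F (toAdd (SurfaceGroup.abelianize g s))) ∧
        ∀ u v : surfaceGen g → ℤ, symplForm (F u) (F v) = ε * symplForm u v :=
  SurfaceGroup.exists_linearEquiv_symplectic

end Summit.SmoothPoincare4.SmoothPoincare4.Theorems.ShadowApproximation.NilpotentGenusClass

end
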